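import Summits.MatrixMultiplication.MatrixMultiplication.Theses.LevelGradedCohnUmans
import Summits.MatrixMultiplication.MatrixMultiplication.Theorems.LieRankDesigns.Negative.Basics

/-!
# `LieRankBeatsCubes` (crux stmt-MatrixMultiplication-14057), negative lane: the top levels `k ≥ m` are
# Cohn–Umans' FULL-budget problem

Negative-lane support file of the crux disprover (cdisprove seat
`refuter-cdisprove-stmt-MatrixMultiplication-14057-0`); everything `sorry`-free, no Theses statement is
asserted.  Vocabulary is the landed `Theorems/LieRankDesigns/Negative/Basics.lean`; the crux is
`∃ p m k X Y Z, RankSep k X Y Z ∧ budget p m k 3 < volume X Y Z` by `Iff.rfl`.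

LOAD-BEARING HYPOTHESIS `k < m`.  `sum_psi_trace_mul` (orthogonality of the trace pairing on `M_m(𝔽_p)`),
`levelSet_eq_univ_of_le` (Fourier inversion: for `k ≥ m` EVERY function on `GL_m(𝔽_p)` has level `k`),
`budget_eq_full_of_le` (the graded budget is then the full `Σ_{χ ∈ Irr} χ(1)^s`), `rankSep_iff_tpp_of_le`
(separation is then EXACTLY the triple product property), `topLevel_slice_iff`: the cells `k ≥ m` of the crux
say precisely "some `GL_m(𝔽_p)` contains a TPP triple beating the full sum of the cubes of its character
degrees" — Cohn–Kleinberg–Szegedy–Umans' "beating the sum of the cubes" inside a general linear group over a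
prime field, OPEN (no construction is known; the quasirandom cap `|G|^{3/2}/√(p−1) + |G|` of BCGPU 2023
Thm 3.2 exceeds `Σ d³ ≈ p^{(3m²−m)/2}` by `≈ √p`, so no catalogued barrier excludes it).  Hence an unconditional
`¬ LieRankBeatsCubes` would contain a theorem of that strength: the live content of the crux is `1 ≤ k < m`.
-/

noncomputable section

open scoped BigOperators
open Literature.RepresentationTheory.FiniteGroups

namespace Summit.MatrixMultiplication.MatrixMultiplication.Theorems.LieRankBeatsCubes.Negative

open Summit.MatrixMultiplication.MatrixMultiplication.Theorems.LieRankDesigns.Negative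

variable {p m : ℕ}

section TopLevel

variable [Fact p.Prime]

/-- Additive characters turn finite sums into products. [folklore] -/
theorem addChar_map_sum_eq_prod {A M : Type*} [AddCommMonoid A] [CommMonoid M] {ι : Type*}
    (ψ : AddChar A M) (s : Finset ι) (x : ι → A) :
    ψ (∑ i ∈ s, x i) = ∏ i ∈ s, ψ (x i) := by
  classical
  induction s using Finset.cons_induction with
  | empty => simp
  | cons a s ha ih => rw [Finset.sum_cons, Finset.prod_cons, AddChar.map_add_eq_mul, ih]

/-- **Orthogonality of the trace pairing on `M_m(𝔽_p)`**:
`Σ_{M ∈ M_m(𝔽_p)} ψ(tr(M D)) = p^{m²}·[D = 0]`. [folklore] -/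
theorem sum_psi_trace_mul (D : Mat p m) :
    ∑ M : Mat p m, ZMod.stdAddChar (Matrix.trace (M * D)) =
      if D = 0 then ((p : ℂ) ^ (m * m)) else 0 := by
  classical
  -- ψ(tr(M D)) = ∏_i ∏_j ψ(M i j * D j i)
  have hexp : ∀ M : Mat p m, ZMod.stdAddChar (Matrix.trace (M * D)) =
      ∏ i : Fin m, ∏ j : Fin m, ZMod.stdAddChar (M i j * D j i) := by
    intro M
    rw [Matrix.trace]
    simp only [Matrix.diag_apply, Matrix.mul_apply]
    rw [addChar_map_sum_eq_prod]
    refine Finset.prod_congr rfl fun i _ => ?_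
    rw [addChar_map_sum_eq_prod]
  simp_rw [hexp]
  -- ∑_M ∏_i ∏_j f i j (M i j) = ∏_i ∏_j ∑_x f i j x
  have hswap : (∑ M : Mat p m, ∏ i : Fin m, ∏ j : Fin m, ZMod.stdAddChar (M i j * D j i)) =
      ∏ i : Fin m, ∏ j : Fin m, ∑ x : ZMod p, ZMod.stdAddChar (x * D j i) := by
    calc (∑ M : Mat p m, ∏ i : Fin m, ∏ j : Fin m, ZMod.stdAddChar (M i j * D j i))
        = ∑ f : Fin m → Fin m → ZMod p, ∏ i : Fin m, ∏ j : Fin m, ZMod.stdAddChar (f i j * D j i) := by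
          rw [← Equiv.sum_comp Matrix.of]
          rfl
      _ = ∏ i : Fin m, ∑ r : Fin m → ZMod p, ∏ j : Fin m, ZMod.stdAddChar (r j * D j i) :=
          (Fintype.prod_sum (fun (i : Fin m) (r : Fin m → ZMod p) =>
            ∏ j : Fin m, ZMod.stdAddChar (r j * D j i))).symm
      _ = ∏ i : Fin m, ∏ j : Fin m, ∑ x : ZMod p, ZMod.stdAddChar (x * D j i) := by
          refine Finset.prod_congr rfl fun i _ => ?_
          exact (Fintype.prod_sum (fun (j : Fin m) (x : ZMod p) => ZMod.stdAddChar (x * D j i))).symm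
  rw [hswap]
  have hinner : ∀ i j : Fin m, (∑ x : ZMod p, ZMod.stdAddChar (x * D j i)) =
      if D j i = 0 then (p : ℂ) else 0 := by
    intro i j
    rw [AddChar.sum_mulShift (D j i) (ZMod.isPrimitive_stdAddChar p), ZMod.card]
    split_ifs <;> simp
  simp_rw [hinner]
  by_cases hD : D = 0
  · subst hD
    simp only [Matrix.zero_apply, if_true]
    rw [Finset.prod_const, Finset.prod_const, Finset.card_univ, Fintype.card_fin, ← pow_mul]
  · rw [if_neg hD]
    obtain ⟨j, i, hji⟩ : ∃ j i, D j i ≠ 0 := by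
      by_contra hall
      push Not at hall
      exact hD (Matrix.ext fun j i => hall j i)
    exact Finset.prod_eq_zero (Finset.mem_univ i)
      (Finset.prod_eq_zero (Finset.mem_univ j) (by rw [if_neg hji]))

/-- **Fourier inversion on `GL_m(𝔽_p)`: for `k ≥ m` EVERY function has level `k`**, i.e.
`levelSet p m k = univ` — the rank restriction is vacuous and the test space is all of `ℂ^G`
(so the graded budget is the FULL one). [folklore] -/
theorem levelSet_eq_univ_of_le {k : ℕ} (hmk : m ≤ k) : levelSet p m k = Set.univ := by
  classical
  refine Set.eq_univ_of_forall fun f => ?_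
  have hp0 : ((p : ℂ) ^ (m * m)) ≠ 0 := pow_ne_zero _ (Nat.cast_ne_zero.mpr (NeZero.ne p))
  refine ⟨fun M => ((p : ℂ) ^ (m * m))⁻¹ *
      ∑ h : GLm p m, f h * ZMod.stdAddChar (Matrix.trace (M * (-(h : Mat p m)))), ?_, fun g => ?_⟩
  · intro M hM
    exfalso
    have := Matrix.rank_le_width M
    omega
  · unfold fourierFn
    have hexp : ∀ M : Mat p m,
        (((p : ℂ) ^ (m * m))⁻¹ * ∑ h : GLm p m, f h * ZMod.stdAddChar (Matrix.trace (M * (-(h : Mat p m))))) *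
          ZMod.stdAddChar (Matrix.trace (M * (g : Mat p m))) =
        ((p : ℂ) ^ (m * m))⁻¹ * ∑ h : GLm p m, f h *
          ZMod.stdAddChar (Matrix.trace (M * ((g : Mat p m) - (h : Mat p m)))) := by
      intro M
      rw [mul_assoc, Finset.sum_mul]
      congr 1
      refine Finset.sum_congr rfl fun h _ => ?_
      rw [mul_assoc, ← AddChar.map_add_eq_mul, ← Matrix.trace_add, ← Matrix.mul_add, neg_add_eq_sub]
    simp_rw [hexp]
    rw [← Finset.mul_sum, Finset.sum_comm]
    simp_rw [← Finset.mul_sum]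
    have hswap : ∀ h : GLm p m, (∑ M : Mat p m, ZMod.stdAddChar (Matrix.trace (M * ((g : Mat p m) - (h : Mat p m)))))
        = if ((g : Mat p m) - (h : Mat p m)) = 0 then ((p : ℂ) ^ (m * m)) else 0 := fun h =>
      sum_psi_trace_mul _
    simp_rw [hswap, sub_eq_zero]
    have hval : ∀ h : GLm p m, f h * (if ((g : Mat p m) = (h : Mat p m)) then ((p : ℂ) ^ (m * m)) else 0) =
        if g = h then f g * (p : ℂ) ^ (m * m) else 0 := by
      intro h
      by_cases hgh : g = h
      · subst hgh; simp
      · rw [if_neg (fun e => hgh (Units.ext e)), if_neg hgh, mul_zero]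
    simp_rw [hval]
    rw [Finset.sum_ite_eq, if_pos (Finset.mem_univ _), ← mul_assoc, mul_comm (((p : ℂ) ^ (m * m))⁻¹),
      mul_assoc, inv_mul_cancel₀ hp0, mul_one]

/-- At the top levels the graded budget is the FULL character-degree sum `Σ_{χ ∈ Irr} χ(1)^s`. -/
theorem budget_eq_full_of_le {k : ℕ} (hmk : m ≤ k) (s : ℝ) :
    budget p m k s = ∑ᶠ χ ∈ irrChars (GLm p m), (χ 1).re ^ s := by
  unfold budget
  rw [levelSet_eq_univ_of_le hmk, Set.inter_univ]


omit [Fact (Nat.Prime p)] in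
/-- **`F_k`-separation ⇒ TPP** (Cohn–Umans Def. 2.1; same argument as the sibling crux's `tpp_of_rankSep`):
from `s s'⁻¹ · t t'⁻¹ · u u'⁻¹ = 1` one gets `s'⁻¹ t t'⁻¹ u = s⁻¹ t t⁻¹ u'`, where the separating function of
the target `(s, u')` takes the value `1`, forcing `s' = s`, `t = t'`, `u = u'`. -/
theorem tpp_of_rankSep' [Fact p.Prime] {k : ℕ} {X Y Z : Finset (GLm p m)} (hsep : RankSep k X Y Z) :
    Literature.Combinatorics.Additive.TripleProductProperty X Y Z := by
  intro s hs s' hs' t ht t' ht' u hu u' hu' h1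
  obtain ⟨c, -, hsepc⟩ := hsep s hs u' hu'
  have htarget := hsepc s hs t ht t ht u' hu'
  rw [if_pos ⟨rfl, rfl, rfl⟩] at htarget
  have hother := hsepc s' hs' t ht t' ht' u hu
  have heq : s'⁻¹ * t * t'⁻¹ * u = s⁻¹ * t * t⁻¹ * u' := by
    have h2 : s'⁻¹ * t * t'⁻¹ * u = s⁻¹ * (s * s'⁻¹ * (t * t'⁻¹) * (u * u'⁻¹)) * u' := by group
    rw [h1] at h2
    rw [h2]; group
  rw [heq, htarget] at hother
  by_cases hc : s' = s ∧ t = t' ∧ u = u'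
  · exact ⟨hc.1.symm, hc.2.1, hc.2.2⟩
  · rw [if_neg hc] at hother
    exact absurd hother one_ne_zero

omit [Fact (Nat.Prime p)] in
/-- Under TPP, an off-target quadruple product never hits the target value. [folklore] -/
theorem quad_eq_target_iff {X Y Z : Finset (GLm p m)}
    (htpp : Literature.Combinatorics.Additive.TripleProductProperty X Y Z)
    {x₀ x y y' z z₀ : GLm p m} (hx₀ : x₀ ∈ X) (hx : x ∈ X) (hy : y ∈ Y) (hy' : y' ∈ Y) (hz : z ∈ Z)
    (hz₀ : z₀ ∈ Z) : x⁻¹ * y * y'⁻¹ * z = x₀⁻¹ * z₀ ↔ (x = x₀ ∧ y = y' ∧ z = z₀) := by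
  constructor
  · intro h
    have h1 : x₀ * x⁻¹ * (y * y'⁻¹) * (z * z₀⁻¹) = 1 := by
      have : x₀ * (x⁻¹ * y * y'⁻¹ * z) * z₀⁻¹ = x₀ * (x₀⁻¹ * z₀) * z₀⁻¹ := by rw [h]
      calc x₀ * x⁻¹ * (y * y'⁻¹) * (z * z₀⁻¹) = x₀ * (x⁻¹ * y * y'⁻¹ * z) * z₀⁻¹ := by group
        _ = x₀ * (x₀⁻¹ * z₀) * z₀⁻¹ := this
        _ = 1 := by group
    obtain ⟨h2, h3, h4⟩ := htpp x₀ hx₀ x hx y hy y' hy' z hz z₀ hz₀ h1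
    exact ⟨h2.symm, h3, h4⟩
  · rintro ⟨rfl, rfl, rfl⟩
    group

/-- **At the top levels separation IS the triple product property.**  For `k ≥ m`,
`RankSep k X Y Z ↔ TPP(X, Y, Z)`: `⇒` is the sibling's `tpp_of_rankSep`; `⇐` takes the delta
function of the target, which has level `k` by `levelSet_eq_univ_of_le`. -/
theorem rankSep_iff_tpp_of_le {k : ℕ} (hmk : m ≤ k) {X Y Z : Finset (GLm p m)} :
    RankSep k X Y Z ↔ Literature.Combinatorics.Additive.TripleProductProperty X Y Z := by
  classical
  refine ⟨tpp_of_rankSep', fun htpp => ?_⟩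
  intro x₀ hx₀ z₀ hz₀
  have hmem : (fun g : GLm p m => if g = x₀⁻¹ * z₀ then (1 : ℂ) else 0) ∈ levelSet p m k := by
    rw [levelSet_eq_univ_of_le hmk]; trivial
  obtain ⟨c, hc, hfc⟩ := hmem
  refine ⟨c, hc, fun x hx y hy y' hy' z hz => ?_⟩
  rw [← hfc]
  dsimp only
  by_cases h : x = x₀ ∧ y = y' ∧ z = z₀
  · rw [if_pos h, if_pos ((quad_eq_target_iff htpp hx₀ hx hy hy' hz hz₀).mpr h)]
  · rw [if_neg h, if_neg (fun e => h ((quad_eq_target_iff htpp hx₀ hx hy hy' hz hz₀).mp e))]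

/-- **THE TOP-LEVEL SLICE OF THE CRUX IS COHN–UMANS' FULL-BUDGET PROBLEM.**  The cells `k ≥ m` of
`LieRankBeatsCubes` say exactly: some `GL_m(𝔽_p)` contains a TPP triple beating the FULL sum of the cubes of
its character degrees — "beating the sum of the cubes" (CKSU 2005, §2) inside a general linear group over a
prime field, an OPEN question (no construction known; the quasirandom cap `|G|^{3/2}/√(p−1) + |G|` of
`BCGPU2023_thm32` exceeds `Σ d³ ≈ p^{(3m²−m)/2}` by a factor `≈ √p`, so no catalogued barrier excludes it).
Consequently an unconditional `¬ LieRankBeatsCubes` would contain a new theorem of that strength. -/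
theorem topLevel_slice_iff :
    (∃ (p : ℕ) (_ : Fact p.Prime) (m k : ℕ) (X Y Z : Finset (GLm p m)),
        m ≤ k ∧ RankSep k X Y Z ∧ budget p m k 3 < volume X Y Z) ↔
    (∃ (p : ℕ) (_ : Fact p.Prime) (m : ℕ) (X Y Z : Finset (GLm p m)),
        Literature.Combinatorics.Additive.TripleProductProperty X Y Z ∧
        (∑ᶠ χ ∈ irrChars (GLm p m), (χ 1).re ^ (3 : ℝ)) < volume X Y Z) := by
  constructor
  · rintro ⟨p, hp, m, k, X, Y, Z, hmk, hsep, hlt⟩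
    exact ⟨p, hp, m, X, Y, Z, (rankSep_iff_tpp_of_le hmk).mp hsep, by rwa [← budget_eq_full_of_le hmk]⟩
  · rintro ⟨p, hp, m, X, Y, Z, htpp, hlt⟩
    exact ⟨p, hp, m, m, X, Y, Z, le_rfl, (rankSep_iff_tpp_of_le le_rfl).mpr htpp,
      by rwa [budget_eq_full_of_le le_rfl]⟩

end TopLevel

end Summit.MatrixMultiplication.MatrixMultiplication.Theorems.LieRankBeatsCubes.Negative

end
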